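import Literature.Barriers.CriticalPhenomena.WeaklySAWGeneratingFunctional
import Literature.Barriers.CriticalPhenomena.WeaklySAWTranslationInvariance
import Literature.Barriers.CriticalPhenomena.WeaklySAWSelfNormalisation
import HarnessLib

/-!
# BBS 2015, §4.1, eqs. (4.16) and (4.27): `χ̂_N = |Λ|⁻¹D²Σ(0,0;1,1)` and
# `χ̂_N = m⁻² + m⁻⁴|Λ|⁻¹ D²Z_N⁰(0,0;1,1)`

The last step of §4.1 of Bauerschmidt–Brydges–Slade, CMP 337 (2015), arXiv:1403.7422. With the constant
test function `1` and the second directional derivative `D²F(0,0;1,1)` of a function of the external field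
and its conjugate in the directions `1` (for `J`) and `1` (for `J̄`) — along the complex line `J = z1` this is
the mixed derivative `∂_z∂_{z̄}F(z1, z̄1)|₀ = ¼Δ_{s,t}F|₀`, `z = s + it` (`wirtingerD2`) —:

* **`chiHatNForm_eq_D2Sigma`** (4.16): `χ̂_N = |Λ|⁻¹ D²Σ(0,0;1,1)` for the generating functional
  `Σ(J,J̄) = E_C(e^{(J,φ̄)+(φ,J̄)}Z₀)` of `WeaklySAWGeneratingFunctional.lean` (by differentiating under the
  super-integral: `D²Σ(0,0;1,1) = E_C((1,φ̄)(1,φ)Z₀)`, `D2Sigma_eq`, and (4.13));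
* **`chiHatNForm_eq_D2ZN0`** (4.27): `χ̂_N = 1/m² + (1/m⁴)|Λ|⁻¹ D²Z_N⁰(0,0;1,1)`, from (4.25)–(4.26)
  (`Σ(z1,z̄1) = e^{|Λ||z|²/m²}Z_N⁰((z/m²)1)`, `genFunctional_const`), the product rule at `z = 0`, and the
  self-normalisation `Z_N⁰(0) = E_C Z₀ = 1` (`WeaklySAWSelfNormalisation.lean`).

Here `m² > 0`, `g₀ > 0`, `ν₀ ∈ ℝ`, `z₀ > -1`. The analytic input (§"Parametric") is differentiation under
the `φ`-integral of `∫ (ℓφ)^k e^{sℓ(φ)} T(φ)dφ` in the real parameter `s` for a linear-growth functional `ℓ`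
and a top coefficient `T` dominated by the Gaussian envelope (`norm_topHC_le_mul`,
`integrable_poly_explin_baseEnvelope`, `hasDerivAt_integral_explin`).

Everything is proved; no named facts.
-/

noncomputable section

open MeasureTheory Filter Topology Set Complex ComplexConjugate
open scoped ENNReal
open Literature.Probability.LatticeModels
open Literature.MathematicalPhysics.QuantumLattice
open Literature.MathematicalPhysics.QuantumLattice.GrassmannAlgebra (berezin)
open scoped BigOperators

namespace Literature.Barriers.CriticalPhenomena

namespace CTWSAW

/-! ### The Gaussian envelope with the observable factored out -/

section Envelope

variable {Λ : Type*} [Fintype Λ] [LinearOrder Λ] {A : Matrix Λ Λ ℂ} {g R : ℝ} {ν : ℂ}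

/-- `K_R (1+‖φ‖)^{2|Λ|} e^{-‖φ‖²}`: the envelope of the `h`-independent factors of `topHC`. [folklore] -/
def baseEnvelope (A : Matrix Λ Λ ℂ) (g R : ℝ) (φ : Λ → ℂ) : ℝ :=
  momentConst A * (1 + 2 * g + R) ^ Fintype.card Λ * Real.exp (Fintype.card Λ * (R + 1) ^ 2 / (4 * g)) *
    ((1 + ‖φ‖) ^ (2 * Fintype.card Λ) * Real.exp (-(1 * ‖φ‖ ^ 2)))

/-- `baseEnvelope ≥ 0`. [folklore] -/
theorem baseEnvelope_nonneg (A : Matrix Λ Λ ℂ) (g R : ℝ) (hg : 0 ≤ g) (hR : 0 ≤ R) (φ : Λ → ℂ) :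
    0 ≤ baseEnvelope A g R φ := by
  unfold baseEnvelope
  have := momentConst_nonneg' A
  positivity

variable [Nonempty Λ]

/-- **`|topHC h| ≤ |h(φ)| · baseEnvelope`** for `‖ν‖ ≤ R` (`R ≥ 0`, `g > 0`, `Re φAφ̄ ≥ 0`). [folklore] -/
theorem norm_topHC_le_mul (hA : ∀ φ, 0 ≤ (Boson.quadForm A φ).re) (hg : 0 < g) (hR : 0 ≤ R) (hν : ‖ν‖ ≤ R)
    (h : FieldFun Λ) (φ : Λ → ℂ) :
    ‖topHC h A g ν φ‖ ≤ ‖h φ‖ * baseEnvelope A g R φ := by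
  set M : ℕ := Fintype.card Λ with hM
  set u : ℝ := 1 + ‖φ‖ with hu
  have h_gw : ‖Boson.gaussWeight A φ‖ ≤ 1 := by
    rw [Boson.norm_gaussWeight]; exact Real.exp_le_one_iff.2 (by linarith [hA φ])
  have h_exp : ‖cexp (-∑ x, interactionScalarC g ν x φ)‖ ≤
      Real.exp (M * (R + 1) ^ 2 / (4 * g)) * Real.exp (-(1 * ‖φ‖ ^ 2)) := by
    rw [Complex.norm_exp, ← Real.exp_add]
    refine Real.exp_le_exp.2 ?_
    have := re_neg_sum_interactionScalarC_le hg hν φ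
    rw [← hM] at this; linarith
  have h_site : siteEnvelope g R φ ≤ (1 + 2 * g + R) ^ M * u ^ (2 * M) := by
    refine (siteEnvelope_le hg.le hR φ).trans (le_of_eq ?_)
    rw [mul_pow, ← pow_mul, hu, hM]
  have hCμ := momentConst_nonneg' A
  have h_P : ‖coeffPoly A g ν φ‖ ≤ momentConst A * ((1 + 2 * g + R) ^ M * u ^ (2 * M)) :=
    (norm_coeffPoly_le hg.le hR hν φ).trans (mul_le_mul_of_nonneg_left h_site hCμ)
  have htop : topHC h A g ν φ = h φ *
      (Boson.gaussWeight A φ * cexp (-∑ x, interactionScalarC g ν x φ)) * coeffPoly A g ν φ := rfl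
  rw [htop]
  simp only [norm_mul]
  calc ‖h φ‖ * (‖Boson.gaussWeight A φ‖ * ‖cexp (-∑ x, interactionScalarC g ν x φ)‖) * ‖coeffPoly A g ν φ‖
      ≤ ‖h φ‖ * (1 * (Real.exp (M * (R + 1) ^ 2 / (4 * g)) * Real.exp (-(1 * ‖φ‖ ^ 2)))) *
          (momentConst A * ((1 + 2 * g + R) ^ M * u ^ (2 * M))) := by
        refine mul_le_mul (mul_le_mul_of_nonneg_left (mul_le_mul h_gw h_exp (norm_nonneg _) zero_le_one)
          (norm_nonneg _)) h_P (norm_nonneg _) (by positivity)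
    _ = ‖h φ‖ * baseEnvelope A g R φ := by
        simp only [baseEnvelope, hM, hu]; ring

omit [LinearOrder Λ] [Nonempty Λ] in
/-- `e^{bu}e^{-u²} ≤ e^{b²/2}e^{-u²/2}`. [folklore] -/
theorem exp_lin_mul_exp_neg_sq_le (b u : ℝ) :
    Real.exp (b * u) * Real.exp (-(1 * u ^ 2)) ≤ Real.exp (b ^ 2 / 2) * Real.exp (-(1 / 2 * u ^ 2)) := by
  rw [← Real.exp_add, ← Real.exp_add]
  refine Real.exp_le_exp.2 ?_
  nlinarith [sq_nonneg (u - b)]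

omit [Nonempty Λ] in
/-- **`(1+‖φ‖)^k e^{b‖φ‖} · baseEnvelope` is integrable** (every real `b`). [folklore] -/
theorem integrable_poly_explin_baseEnvelope (A : Matrix Λ Λ ℂ) {g R : ℝ} (hg : 0 ≤ g) (hR : 0 ≤ R) (k : ℕ)
    (b : ℝ) :
    Integrable fun φ : Λ → ℂ => (1 + ‖φ‖) ^ k * Real.exp (b * ‖φ‖) * baseEnvelope A g R φ := by
  set K₀ : ℝ := momentConst A * (1 + 2 * g + R) ^ Fintype.card Λ *
    Real.exp (Fintype.card Λ * (R + 1) ^ 2 / (4 * g)) with hK₀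
  have hK₀0 : 0 ≤ K₀ := by have := momentConst_nonneg' A; positivity
  have hdom := ((Boson.integrable_one_add_norm_pow_mul_exp_neg (Λ := Λ) (c := 1 / 2) (by norm_num)
    (k + 2 * Fintype.card Λ)).const_mul (K₀ * Real.exp (b ^ 2 / 2)))
  refine hdom.mono' ?_ (Eventually.of_forall fun φ => ?_)
  · have hc : Continuous fun φ : Λ → ℂ => (1 + ‖φ‖) ^ k * Real.exp (b * ‖φ‖) * baseEnvelope A g R φ := by
      unfold baseEnvelope; fun_prop
    exact hc.aestronglyMeasurable
  · have hpos : 0 ≤ (1 + ‖φ‖) ^ k * Real.exp (b * ‖φ‖) * baseEnvelope A g R φ := by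
      have := baseEnvelope_nonneg A g R hg hR φ; positivity
    rw [Real.norm_eq_abs, abs_of_nonneg hpos, baseEnvelope, ← hK₀]
    have hkey := exp_lin_mul_exp_neg_sq_le b ‖φ‖
    have hu : 0 ≤ (1 + ‖φ‖) ^ k * (1 + ‖φ‖) ^ (2 * Fintype.card Λ) := by positivity
    calc (1 + ‖φ‖) ^ k * Real.exp (b * ‖φ‖) * (K₀ * ((1 + ‖φ‖) ^ (2 * Fintype.card Λ) *
          Real.exp (-(1 * ‖φ‖ ^ 2))))
        = K₀ * ((1 + ‖φ‖) ^ k * (1 + ‖φ‖) ^ (2 * Fintype.card Λ)) *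
            (Real.exp (b * ‖φ‖) * Real.exp (-(1 * ‖φ‖ ^ 2))) := by ring
      _ ≤ K₀ * ((1 + ‖φ‖) ^ k * (1 + ‖φ‖) ^ (2 * Fintype.card Λ)) *
            (Real.exp (b ^ 2 / 2) * Real.exp (-(1 / 2 * ‖φ‖ ^ 2))) :=
          mul_le_mul_of_nonneg_left hkey (mul_nonneg hK₀0 hu)
      _ = K₀ * Real.exp (b ^ 2 / 2) * ((1 + ‖φ‖) ^ (k + 2 * Fintype.card Λ) *
            Real.exp (-(1 / 2 * ‖φ‖ ^ 2))) := by rw [pow_add]; ring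

end Envelope

/-! ### Differentiating `∫ (ℓφ)^k e^{sℓ(φ)} T(φ) dφ` in the real parameter `s` -/

section Parametric

variable {Λ : Type*} [Fintype Λ] [LinearOrder Λ] {A : Matrix Λ Λ ℂ} {g R L : ℝ} {T ℓ : (Λ → ℂ) → ℂ}

/-- The integrand `(ℓφ)^k e^{sℓ(φ)} T(φ)`. [folklore] -/
def explinIntegrand (ℓ T : (Λ → ℂ) → ℂ) (k : ℕ) (s : ℝ) (φ : Λ → ℂ) : ℂ :=
  (ℓ φ) ^ k * cexp ((s : ℂ) * ℓ φ) * T φ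

omit [Fintype Λ] [LinearOrder Λ] in
/-- `∂_s [(ℓφ)^k e^{sℓ} T] = (ℓφ)^{k+1} e^{sℓ} T`. [folklore] -/
theorem hasDerivAt_explinIntegrand (ℓ T : (Λ → ℂ) → ℂ) (k : ℕ) (φ : Λ → ℂ) (s : ℝ) :
    HasDerivAt (fun s => explinIntegrand ℓ T k s φ) (explinIntegrand ℓ T (k + 1) s φ) s := by
  have h1 : HasDerivAt (fun y : ℝ => (y : ℂ)) 1 s := by
    simpa using (hasDerivAt_id s).ofReal_comp
  have h2 := (((h1.mul_const (ℓ φ)).cexp).const_mul ((ℓ φ) ^ k)).mul_const (T φ)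
  refine h2.congr_deriv ?_
  simp only [explinIntegrand]
  ring

omit [Fintype Λ] [LinearOrder Λ] in
/-- Continuity of the integrand in `φ`. [folklore] -/
theorem continuous_explinIntegrand (hℓ : Continuous ℓ) (hT : Continuous T) (k : ℕ) (s : ℝ) :
    Continuous fun φ => explinIntegrand ℓ T k s φ := by
  unfold explinIntegrand
  exact ((hℓ.pow k).mul (Complex.continuous_exp.comp (continuous_const.mul hℓ))).mul hT

/-- **The domination**: for `|s| ≤ S`, `‖(ℓφ)^k e^{sℓ} T‖ ≤ L^k e^{SL} · (1+‖φ‖)^k e^{SL‖φ‖} baseEnvelope`. [folklore] -/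
theorem norm_explinIntegrand_le (hg : 0 ≤ g) (hR : 0 ≤ R) (hTb : ∀ φ, ‖T φ‖ ≤ baseEnvelope A g R φ)
    (hL : 0 ≤ L) (hℓb : ∀ φ, ‖ℓ φ‖ ≤ L * (1 + ‖φ‖)) (k : ℕ) {S s : ℝ} (hs : |s| ≤ S) (φ : Λ → ℂ) :
    ‖explinIntegrand ℓ T k s φ‖ ≤ L ^ k * Real.exp (S * L) *
      ((1 + ‖φ‖) ^ k * Real.exp (S * L * ‖φ‖) * baseEnvelope A g R φ) := by
  have hu0 : 0 ≤ 1 + ‖φ‖ := by positivity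
  have hℓ0 := hℓb φ
  have hS : 0 ≤ S := (abs_nonneg s).trans hs
  have hpow : ‖ℓ φ‖ ^ k ≤ (L * (1 + ‖φ‖)) ^ k := pow_le_pow_left₀ (norm_nonneg _) hℓ0 k
  have hexp : ‖cexp ((s : ℂ) * ℓ φ)‖ ≤ Real.exp (S * L) * Real.exp (S * L * ‖φ‖) := by
    rw [Complex.norm_exp, ← Real.exp_add]
    refine Real.exp_le_exp.2 ?_
    calc ((s : ℂ) * ℓ φ).re ≤ ‖(s : ℂ) * ℓ φ‖ := Complex.re_le_norm _
      _ = |s| * ‖ℓ φ‖ := by rw [norm_mul, Complex.norm_real, Real.norm_eq_abs]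
      _ ≤ S * (L * (1 + ‖φ‖)) := mul_le_mul hs hℓ0 (norm_nonneg _) hS
      _ = S * L + S * L * ‖φ‖ := by ring
  have hB := baseEnvelope_nonneg A g R hg hR φ
  unfold explinIntegrand
  rw [norm_mul, norm_mul, norm_pow]
  calc ‖ℓ φ‖ ^ k * ‖cexp ((s : ℂ) * ℓ φ)‖ * ‖T φ‖
      ≤ (L * (1 + ‖φ‖)) ^ k * (Real.exp (S * L) * Real.exp (S * L * ‖φ‖)) * baseEnvelope A g R φ :=
        mul_le_mul (mul_le_mul hpow hexp (norm_nonneg _) (by positivity)) (hTb φ) (norm_nonneg _) (by positivity)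
    _ = L ^ k * Real.exp (S * L) * ((1 + ‖φ‖) ^ k * Real.exp (S * L * ‖φ‖) * baseEnvelope A g R φ) := by
        rw [mul_pow]; ring

/-- Integrability of the integrand. [folklore] -/
theorem integrable_explinIntegrand (hg : 0 ≤ g) (hR : 0 ≤ R) (hT : Continuous T)
    (hTb : ∀ φ, ‖T φ‖ ≤ baseEnvelope A g R φ) (hℓ : Continuous ℓ) (hL : 0 ≤ L)
    (hℓb : ∀ φ, ‖ℓ φ‖ ≤ L * (1 + ‖φ‖)) (k : ℕ) (s : ℝ) :
    Integrable fun φ => explinIntegrand ℓ T k s φ :=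
  ((integrable_poly_explin_baseEnvelope A hg hR k (|s| * L)).const_mul
    (L ^ k * Real.exp (|s| * L))).mono' (continuous_explinIntegrand hℓ hT k s).aestronglyMeasurable
    (Eventually.of_forall fun φ => norm_explinIntegrand_le hg hR hTb hL hℓb k le_rfl φ)

/-- **Differentiation under the integral sign** in the real parameter `s`:
`d/ds ∫ (ℓφ)^k e^{sℓ} T dφ = ∫ (ℓφ)^{k+1} e^{sℓ} T dφ`. [folklore] -/
theorem hasDerivAt_integral_explin (hg : 0 ≤ g) (hR : 0 ≤ R) (hT : Continuous T)
    (hTb : ∀ φ, ‖T φ‖ ≤ baseEnvelope A g R φ) (hℓ : Continuous ℓ) (hL : 0 ≤ L)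
    (hℓb : ∀ φ, ‖ℓ φ‖ ≤ L * (1 + ‖φ‖)) (k : ℕ) (s₀ : ℝ) :
    HasDerivAt (fun s => ∫ φ, explinIntegrand ℓ T k s φ) (∫ φ, explinIntegrand ℓ T (k + 1) s₀ φ) s₀ := by
  set S : ℝ := |s₀| + 1 with hSdef
  have hball : ∀ s ∈ Metric.ball s₀ 1, |s| ≤ S := fun s hs => by
    have h := Metric.mem_ball.1 hs
    rw [Real.dist_eq] at h
    have := abs_sub_abs_le_abs_sub s s₀
    rw [hSdef]; linarith
  set bound : (Λ → ℂ) → ℝ := fun φ => L ^ (k + 1) * Real.exp (S * L) *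
    ((1 + ‖φ‖) ^ (k + 1) * Real.exp (S * L * ‖φ‖) * baseEnvelope A g R φ) with hbound
  have hbint : Integrable bound :=
    (integrable_poly_explin_baseEnvelope A hg hR (k + 1) (S * L)).const_mul _
  exact (hasDerivAt_integral_of_dominated_loc_of_deriv_le (μ := volume) (x₀ := s₀)
    (s := Metric.ball s₀ 1) (F := fun s φ => explinIntegrand ℓ T k s φ)
    (F' := fun s φ => explinIntegrand ℓ T (k + 1) s φ) (bound := bound) (Metric.ball_mem_nhds s₀ one_pos)
    (Eventually.of_forall fun s => (continuous_explinIntegrand hℓ hT k s).aestronglyMeasurable)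
    (integrable_explinIntegrand hg hR hT hTb hℓ hL hℓb k s₀)
    (continuous_explinIntegrand hℓ hT (k + 1) s₀).aestronglyMeasurable
    (Eventually.of_forall fun φ s hs => norm_explinIntegrand_le hg hR hTb hL hℓb (k + 1) (hball s hs) φ)
    hbint (Eventually.of_forall fun φ s _ => hasDerivAt_explinIntegrand ℓ T k φ s)).2

/-- **The second derivative at `0`**: `(d/ds)² ∫ e^{sℓ} T dφ |₀ = ∫ ℓ² T dφ` (as `iteratedDeriv 2`, scaled
by a constant). [folklore] -/
theorem iteratedDeriv_two_integral_explin (hg : 0 ≤ g) (hR : 0 ≤ R) (hT : Continuous T)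
    (hTb : ∀ φ, ‖T φ‖ ≤ baseEnvelope A g R φ) (hℓ : Continuous ℓ) (hL : 0 ≤ L)
    (hℓb : ∀ φ, ‖ℓ φ‖ ≤ L * (1 + ‖φ‖)) (c : ℂ) :
    iteratedDeriv 2 (fun s : ℝ => c * ∫ φ, explinIntegrand ℓ T 0 s φ) 0 =
      c * ∫ φ, (ℓ φ) ^ 2 * T φ := by
  have h0 : ∀ s, HasDerivAt (fun s : ℝ => c * ∫ φ, explinIntegrand ℓ T 0 s φ)
      (c * ∫ φ, explinIntegrand ℓ T 1 s φ) s := fun s =>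
    (hasDerivAt_integral_explin hg hR hT hTb hℓ hL hℓb 0 s).const_mul c
  have h1 : ∀ s, HasDerivAt (fun s : ℝ => c * ∫ φ, explinIntegrand ℓ T 1 s φ)
      (c * ∫ φ, explinIntegrand ℓ T 2 s φ) s := fun s =>
    (hasDerivAt_integral_explin hg hR hT hTb hℓ hL hℓb 1 s).const_mul c
  have hd0 : deriv (fun s : ℝ => c * ∫ φ, explinIntegrand ℓ T 0 s φ) =
      fun s => c * ∫ φ, explinIntegrand ℓ T 1 s φ := funext fun s => (h0 s).deriv
  rw [iteratedDeriv_succ, iteratedDeriv_one, hd0, (h1 0).deriv]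
  congr 1
  refine integral_congr_ae (Eventually.of_forall fun φ => ?_)
  simp [explinIntegrand]

end Parametric

/-! ### A second-derivative computation: `(e^{-Ks²} S(as))''(0) = -2K·S(0) + a²S''(0)` -/

section Calculus

/-- **Product/chain rule at `0`**: for `S` with derivatives `S'`, `S''` everywhere,
`(d/ds)²[e^{-Ks²} S(as)]|₀ = -2K S(0) + a² S''(0)`. [folklore] -/
theorem iteratedDeriv_two_cexp_mul_comp {S S' S'' : ℝ → ℂ} (hS : ∀ s, HasDerivAt S (S' s) s)
    (hS' : ∀ s, HasDerivAt S' (S'' s) s) (K a : ℝ) :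
    iteratedDeriv 2 (fun s : ℝ => cexp (-((K : ℂ) * (s : ℂ) ^ 2)) * S (a * s)) 0 =
      -(2 * (K : ℂ)) * S 0 + (a : ℂ) ^ 2 * S'' 0 := by
  -- the Gaussian factor and its derivative
  set E : ℝ → ℂ := fun s => cexp (-((K : ℂ) * (s : ℂ) ^ 2)) with hE
  set D : ℝ → ℂ := fun s => -((K : ℂ) * (2 * (s : ℂ))) with hD
  have hofReal : ∀ s : ℝ, HasDerivAt (fun y : ℝ => (y : ℂ)) 1 s := fun s => by
    simpa using (hasDerivAt_id s).ofReal_comp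
  have hEd : ∀ s, HasDerivAt E (E s * D s) s := by
    intro s
    have h1 : HasDerivAt (fun y : ℝ => -((K : ℂ) * (y : ℂ) ^ 2)) (-((K : ℂ) * (2 * (s : ℂ) * 1))) s :=
      (((hofReal s).pow 2).const_mul (K : ℂ)).neg.congr_deriv (by norm_num)
    refine h1.cexp.congr_deriv ?_
    simp only [hE, hD]; ring
  have hDd : ∀ s, HasDerivAt D (-((K : ℂ) * 2)) s := fun s =>
    (((hofReal s).const_mul (2 : ℂ)).const_mul (K : ℂ)).neg.congr_deriv (by ring)
  -- the composed factor
  have hSa : ∀ s, HasDerivAt (fun s : ℝ => S (a * s)) (S' (a * s) * a) s := fun s => by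
    have h := (hS (a * s)).scomp s ((hasDerivAt_id' s).const_mul a)
    refine h.congr_deriv ?_
    rw [mul_one, Complex.real_smul, mul_comm]
  have hS'a : ∀ s, HasDerivAt (fun s : ℝ => S' (a * s)) (S'' (a * s) * a) s := fun s => by
    have h := (hS' (a * s)).scomp s ((hasDerivAt_id' s).const_mul a)
    refine h.congr_deriv ?_
    rw [mul_one, Complex.real_smul, mul_comm]
  -- first derivative everywhere
  set G' : ℝ → ℂ := fun s => E s * D s * S (a * s) + E s * (S' (a * s) * a) with hG'
  have hG : ∀ s, HasDerivAt (fun s : ℝ => E s * S (a * s)) (G' s) s := fun s =>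
    ((hEd s).mul (hSa s)).congr_deriv (by simp only [hG'])
  have hderiv : deriv (fun s : ℝ => cexp (-((K : ℂ) * (s : ℂ) ^ 2)) * S (a * s)) = G' :=
    funext fun s => (hG s).deriv
  -- second derivative at `0`
  have hG'd : HasDerivAt G' ((E 0 * D 0 * D 0 + E 0 * (-((K : ℂ) * 2))) * S (a * 0) + E 0 * D 0 * (S' (a * 0) * a) +
      (E 0 * D 0 * (S' (a * 0) * a) + E 0 * (S'' (a * 0) * a * a))) 0 := by
    have hA := ((hEd 0).mul (hDd 0)).mul (hSa 0)
    have hB := (hEd 0).mul ((hS'a 0).mul_const ((a : ℂ)))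
    have hAB := hA.add hB
    refine hAB.congr_deriv ?_
    simp only [Pi.mul_apply]
  rw [iteratedDeriv_succ, iteratedDeriv_one, hderiv, hG'd.deriv]
  have hE0 : E 0 = 1 := by simp [hE]
  have hD0 : D 0 = 0 := by simp [hD]
  simp only [hE0, hD0, mul_zero]
  ring

end Calculus

/-! ### The torus: `D²Σ(0,0;1,1)`, `D²Z_N⁰(0,0;1,1)`, (4.16) and (4.27) -/

section Torus

variable {d n : ℕ} [NeZero n]

attribute [-instance] Fintype.decidablePiFintype

/-- **`D²F(0,0;1,1)` along the constant test function**: for a function `F` of the (constant) external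
field amplitude `z` (standing for `F(z1, z̄1)`), the mixed second derivative `∂_z∂_{z̄}F|₀ = ¼(∂_s² + ∂_t²)F|₀`,
`z = s + it`. [cite: BauerschmidtBrydgesSlade2015LogCorr, §4.1, eq. (4.16) ("the directional derivative with directions equal to the constant function 1 in the first and second argument")] -/
def wirtingerD2 (F : ℂ → ℂ) : ℂ :=
  (1 / 4 : ℂ) * (iteratedDeriv 2 (fun s : ℝ => F (s : ℂ)) 0 + iteratedDeriv 2 (fun t : ℝ => F ((t : ℂ) * I)) 0)

/-- **`D²Σ(0,0;1,1)`** for `Σ(J,J̄) = E_C(e^{(J,φ̄)+(φ,J̄)}Z₀)`. [cite: BauerschmidtBrydgesSlade2015LogCorr, §4.1, eq. (4.16)] -/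
def D2Sigma (d n : ℕ) [NeZero n] (m2 g₀ ν₀ z₀ : ℝ) : ℂ :=
  wirtingerD2 fun z => genFunctional d n m2 g₀ ν₀ z₀ fun _ => z

/-- **`D²Z_N⁰(0,0;1,1)`** for `Z_N⁰(h) = E_C(Z₀(h+φ, …))`. [cite: BauerschmidtBrydgesSlade2015LogCorr, §4.1, eq. (4.27)] -/
def D2ZN0 (d n : ℕ) [NeZero n] (m2 g₀ ν₀ z₀ : ℝ) : ℂ :=
  wirtingerD2 fun w => ZN0 d n m2 g₀ ν₀ z₀ fun _ => w

variable {m2 g₀ ν₀ z₀ : ℝ}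

/-- The kinetic matrix after rescaling, `(1+z₀)(-Δ)`. [folklore] -/
def rescaledLaplacian (d n : ℕ) [NeZero n] (z₀ : ℝ) : Matrix (TorusSite d n) (TorusSite d n) ℂ :=
  (((1 + z₀ : ℝ)) : ℂ) • negLaplacianC d n

/-- `e^{-S_{-Δ+m²}} · f · Z₀ = f · e^{-S_{(1+z₀)(-Δ)}} e^{-Σ(g₀τ²+(ν₀+m²)τ)}`. [folklore] -/
theorem superGauss_mass_mul_ofFun_mul_boltzmannZ0 (hm : 0 < m2) (f : FieldFun (TorusSite d n)) :
    superGauss (freeCovariance d n m2)⁻¹ * (ofFun f * boltzmannZ0 g₀ ν₀ z₀) =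
      ofFun f * (superGauss (rescaledLaplacian d n z₀) * interactionForm g₀ (ν₀ + m2)) := by
  rw [freeCovariance_inv hm, boltzmannZ0, ← mul_assoc, (commute_superGauss _ _).eq, mul_assoc,
    ← mul_assoc (superGauss _), massLaplacianC, superGauss_mul_superGauss, rescaledLaplacian,
    show negLaplacianC d n + Matrix.diagonal (fun _ => (m2 : ℂ)) + (z₀ : ℂ) • negLaplacianC d n =
      (((1 + z₀ : ℝ)) : ℂ) • negLaplacianC d n + Matrix.diagonal (fun _ => (m2 : ℂ)) by
        push_cast; rw [add_smul, one_smul]; abel,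
    superGauss_add_diagonal_mul_interactionForm]

/-- `Re φ((1+z₀)(-Δ))φ̄ ≥ 0` for `z₀ > -1`. [folklore] -/
theorem re_quadForm_rescaledLaplacian_nonneg (hz : -1 < z₀) (φ : TorusSite d n → ℂ) :
    0 ≤ (Boson.quadForm (rescaledLaplacian d n z₀) φ).re :=
  re_quadForm_smul_nonneg re_quadForm_negLaplacianC_nonneg (by linarith) φ

/-- The `h`-independent top coefficient `T(φ) = topHC 1`. [folklore] -/
def topBase (d n : ℕ) [NeZero n] (m2 g₀ ν₀ z₀ : ℝ) (φ : TorusSite d n → ℂ) : ℂ :=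
  topHC 1 (rescaledLaplacian d n z₀) g₀ ((ν₀ + m2 : ℝ) : ℂ) φ

/-- `topHC h = h · topHC 1`. [folklore] -/
theorem topHC_eq_mul_topBase (h : FieldFun (TorusSite d n)) (φ : TorusSite d n → ℂ) :
    topHC h (rescaledLaplacian d n z₀) g₀ ((ν₀ + m2 : ℝ) : ℂ) φ = h φ * topBase d n m2 g₀ ν₀ z₀ φ := by
  simp only [topHC, topBase, Pi.one_apply, one_mul]
  ring

/-- **`E_C(f Z₀) = ε π^{-|Λ|} ∫ f(φ) T(φ) dφ`** for every `0`-form observable `f` (`m² > 0`). [folklore] -/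
theorem superExpectation_ofFun_mul_boltzmannZ0_eq_integral (hm : 0 < m2) (f : FieldFun (TorusSite d n)) :
    superExpectation (freeCovariance d n m2) (ofFun f * boltzmannZ0 g₀ ν₀ z₀) =
      orientSign (TorusSite d n) * ((Real.pi : ℂ)⁻¹) ^ Fintype.card (TorusSite d n) *
        ∫ φ, f φ * topBase d n m2 g₀ ν₀ z₀ φ := by
  rw [superExpectation, superGauss_mass_mul_ofFun_mul_boltzmannZ0 hm, ← interactionFormC_ofReal, ← obsSideC,
    obsSideC_eq_integral]
  congr 1
  exact integral_congr_ae (Eventually.of_forall fun φ => topHC_eq_mul_topBase f φ)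

/-- `T` is continuous. [folklore] -/
theorem continuous_topBase : Continuous (topBase d n m2 g₀ ν₀ z₀) :=
  continuous_topHC continuous_const _ _ _

/-- `‖T(φ)‖ ≤ baseEnvelope` (`R = |ν₀+m²|`, `g₀ > 0`, `z₀ > -1`). [folklore] -/
theorem norm_topBase_le (hg₀ : 0 < g₀) (hz : -1 < z₀) (φ : TorusSite d n → ℂ) :
    ‖topBase d n m2 g₀ ν₀ z₀ φ‖ ≤ baseEnvelope (rescaledLaplacian d n z₀) g₀ ‖((ν₀ + m2 : ℝ) : ℂ)‖ φ := by
  have h := norm_topHC_le_mul (ν := ((ν₀ + m2 : ℝ) : ℂ)) (R := ‖((ν₀ + m2 : ℝ) : ℂ)‖)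
    (re_quadForm_rescaledLaplacian_nonneg hz) hg₀ (norm_nonneg _) le_rfl 1 φ
  simpa [topBase] using h

/-! #### The two real directions `ℓ₁ = (1,φ̄) + (1,φ)`, `ℓ₂ = i((1,φ̄) - (1,φ))` -/

/-- `(1,φ̄) = Σ_x φ̄_x`. [folklore] -/
def sumBar (φ : TorusSite d n → ℂ) : ℂ := ∑ x, conj (φ x)

/-- `(1,φ) = Σ_x φ_x`. [folklore] -/
def sumPhi (φ : TorusSite d n → ℂ) : ℂ := ∑ x, φ x

/-- `ℓ₁ = (1,φ̄) + (1,φ)` (the exponent of `e^{(J,φ̄)+(φ,J̄)}` for `J = s1`, `s` real, is `sℓ₁`). [folklore] -/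
def ellRe (φ : TorusSite d n → ℂ) : ℂ := sumBar φ + sumPhi φ

/-- `ℓ₂ = i((1,φ̄) - (1,φ))` (the exponent for `J = it1`, `t` real, is `tℓ₂`). [folklore] -/
def ellIm (φ : TorusSite d n → ℂ) : ℂ := I * (sumBar φ - sumPhi φ)

/-- `‖Σ_x φ̄_x‖ ≤ |Λ|‖φ‖`. [folklore] -/
theorem norm_sumBar_le (φ : TorusSite d n → ℂ) : ‖sumBar φ‖ ≤ Fintype.card (TorusSite d n) * ‖φ‖ := by
  unfold sumBar
  calc ‖∑ x, conj (φ x)‖ ≤ ∑ x, ‖conj (φ x)‖ := norm_sum_le _ _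
    _ ≤ ∑ _x : TorusSite d n, ‖φ‖ := Finset.sum_le_sum fun x _ => by
        rw [Complex.norm_conj]; exact norm_le_pi_norm φ x
    _ = Fintype.card (TorusSite d n) * ‖φ‖ := by rw [Finset.sum_const, Finset.card_univ, nsmul_eq_mul]

/-- `‖Σ_x φ_x‖ ≤ |Λ|‖φ‖`. [folklore] -/
theorem norm_sumPhi_le (φ : TorusSite d n → ℂ) : ‖sumPhi φ‖ ≤ Fintype.card (TorusSite d n) * ‖φ‖ := by
  unfold sumPhi
  calc ‖∑ x, φ x‖ ≤ ∑ x, ‖φ x‖ := norm_sum_le _ _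
    _ ≤ ∑ _x : TorusSite d n, ‖φ‖ := Finset.sum_le_sum fun x _ => norm_le_pi_norm φ x
    _ = Fintype.card (TorusSite d n) * ‖φ‖ := by rw [Finset.sum_const, Finset.card_univ, nsmul_eq_mul]

/-- `‖ℓ₁(φ)‖ ≤ 2|Λ|(1+‖φ‖)`. [folklore] -/
theorem norm_ellRe_le (φ : TorusSite d n → ℂ) : ‖ellRe φ‖ ≤ 2 * Fintype.card (TorusSite d n) * (1 + ‖φ‖) := by
  unfold ellRe
  have h := (norm_add_le _ _).trans (add_le_add (norm_sumBar_le φ) (norm_sumPhi_le φ))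
  have hM : (0 : ℝ) ≤ Fintype.card (TorusSite d n) := Nat.cast_nonneg _
  nlinarith [norm_nonneg φ]

/-- `‖ℓ₂(φ)‖ ≤ 2|Λ|(1+‖φ‖)`. [folklore] -/
theorem norm_ellIm_le (φ : TorusSite d n → ℂ) : ‖ellIm φ‖ ≤ 2 * Fintype.card (TorusSite d n) * (1 + ‖φ‖) := by
  unfold ellIm
  rw [norm_mul, Complex.norm_I, one_mul]
  have h := (norm_sub_le _ _).trans (add_le_add (norm_sumBar_le φ) (norm_sumPhi_le φ))
  have hM : (0 : ℝ) ≤ Fintype.card (TorusSite d n) := Nat.cast_nonneg _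
  nlinarith [norm_nonneg φ]

/-- `ℓ₁` is continuous. [folklore] -/
theorem continuous_ellRe : Continuous (ellRe (d := d) (n := n)) := by
  unfold ellRe sumBar sumPhi; fun_prop

/-- `ℓ₂` is continuous. [folklore] -/
theorem continuous_ellIm : Continuous (ellIm (d := d) (n := n)) := by
  unfold ellIm sumBar sumPhi; fun_prop

/-- **`¼(ℓ₁² + ℓ₂²) = (1,φ̄)(1,φ)`**. [folklore] -/
theorem quarter_ellRe_sq_add_ellIm_sq (φ : TorusSite d n → ℂ) :
    (1 / 4 : ℂ) * (ellRe φ ^ 2 + ellIm φ ^ 2) = sumBar φ * sumPhi φ := by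
  unfold ellRe ellIm
  have hI : I ^ 2 = -1 := Complex.I_sq
  linear_combination (sumBar φ - sumPhi φ) ^ 2 / 4 * hI

/-- The exponent of `e^{(J,φ̄)+(φ,J̄)}` for the real constant field `J = s1` is `sℓ₁`. [folklore] -/
theorem extSource_real (s : ℝ) :
    extSource (d := d) (n := n) (fun _ => (s : ℂ)) = ofFun fun φ => cexp ((s : ℂ) * ellRe φ) := by
  unfold extSource
  congr 1
  funext φ
  congr 1
  simp only [pair, ellRe, sumBar, sumPhi, Complex.conj_ofReal]
  rw [← Finset.mul_sum, ← Finset.sum_mul]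
  ring

/-- The exponent for the imaginary constant field `J = it1` is `tℓ₂`. [folklore] -/
theorem extSource_imag (t : ℝ) :
    extSource (d := d) (n := n) (fun _ => (t : ℂ) * I) = ofFun fun φ => cexp ((t : ℂ) * ellIm φ) := by
  unfold extSource
  congr 1
  funext φ
  congr 1
  simp only [pair, ellIm, sumBar, sumPhi, map_mul, Complex.conj_ofReal, Complex.conj_I]
  rw [← Finset.mul_sum, ← Finset.sum_mul]
  ring

/-! #### `Σ` along the two axes as parametric integrals; `D²Σ(0,0;1,1) = E_C((1,φ̄)(1,φ)Z₀)` -/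

/-- The normalising constant `ε π^{-|Λ|}`. [folklore] -/
def normConst (d n : ℕ) [NeZero n] : ℂ :=
  orientSign (TorusSite d n) * ((Real.pi : ℂ)⁻¹) ^ Fintype.card (TorusSite d n)

/-- `Σ(s1, s1) = επ^{-|Λ|} ∫ e^{sℓ₁} T`. [folklore] -/
theorem genFunctional_real_eq_integral (hm : 0 < m2) (s : ℝ) :
    genFunctional d n m2 g₀ ν₀ z₀ (fun _ => (s : ℂ)) =
      normConst d n * ∫ φ, explinIntegrand ellRe (topBase d n m2 g₀ ν₀ z₀) 0 s φ := by
  rw [genFunctional, extSource_real, superExpectation_ofFun_mul_boltzmannZ0_eq_integral hm, normConst]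
  congr 1
  refine integral_congr_ae (Eventually.of_forall fun φ => ?_)
  simp [explinIntegrand]

/-- `Σ(it1, -it1) = επ^{-|Λ|} ∫ e^{tℓ₂} T`. [folklore] -/
theorem genFunctional_imag_eq_integral (hm : 0 < m2) (t : ℝ) :
    genFunctional d n m2 g₀ ν₀ z₀ (fun _ => (t : ℂ) * I) =
      normConst d n * ∫ φ, explinIntegrand ellIm (topBase d n m2 g₀ ν₀ z₀) 0 t φ := by
  rw [genFunctional, extSource_imag, superExpectation_ofFun_mul_boltzmannZ0_eq_integral hm, normConst]
  congr 1
  refine integral_congr_ae (Eventually.of_forall fun φ => ?_)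
  simp [explinIntegrand]

/-- `0 ≤ 2|Λ|`. [folklore] -/
theorem two_card_nonneg : (0 : ℝ) ≤ 2 * Fintype.card (TorusSite d n) := by positivity

/-- **`Σ` is differentiable along the real axis**, with derivative the parametric integral of order one. [folklore] -/
theorem hasDerivAt_genFunctional_real (hg₀ : 0 < g₀) (hz : -1 < z₀) (k : ℕ) (s : ℝ) :
    HasDerivAt (fun s : ℝ => normConst d n * ∫ φ, explinIntegrand ellRe (topBase d n m2 g₀ ν₀ z₀) k s φ)
      (normConst d n * ∫ φ, explinIntegrand ellRe (topBase d n m2 g₀ ν₀ z₀) (k + 1) s φ) s :=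
  (hasDerivAt_integral_explin (L := 2 * Fintype.card (TorusSite d n)) hg₀.le (norm_nonneg _) continuous_topBase
    (norm_topBase_le hg₀ hz) continuous_ellRe two_card_nonneg norm_ellRe_le k s).const_mul _

/-- The same along the imaginary axis. [folklore] -/
theorem hasDerivAt_genFunctional_imag (hg₀ : 0 < g₀) (hz : -1 < z₀) (k : ℕ) (t : ℝ) :
    HasDerivAt (fun t : ℝ => normConst d n * ∫ φ, explinIntegrand ellIm (topBase d n m2 g₀ ν₀ z₀) k t φ)
      (normConst d n * ∫ φ, explinIntegrand ellIm (topBase d n m2 g₀ ν₀ z₀) (k + 1) t φ) t :=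
  (hasDerivAt_integral_explin (L := 2 * Fintype.card (TorusSite d n)) hg₀.le (norm_nonneg _) continuous_topBase
    (norm_topBase_le hg₀ hz) continuous_ellIm two_card_nonneg norm_ellIm_le k t).const_mul _

/-- `∂_s² Σ(s1,s1)|₀ = επ^{-|Λ|} ∫ ℓ₁² T`. [folklore] -/
theorem iteratedDeriv_two_genFunctional_real (hm : 0 < m2) (hg₀ : 0 < g₀) (hz : -1 < z₀) :
    iteratedDeriv 2 (fun s : ℝ => genFunctional d n m2 g₀ ν₀ z₀ (fun _ => (s : ℂ))) 0 =
      normConst d n * ∫ φ, (ellRe φ) ^ 2 * topBase d n m2 g₀ ν₀ z₀ φ := by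
  have hfun : (fun s : ℝ => genFunctional d n m2 g₀ ν₀ z₀ (fun _ => (s : ℂ))) =
      fun s => normConst d n * ∫ φ, explinIntegrand ellRe (topBase d n m2 g₀ ν₀ z₀) 0 s φ :=
    funext fun s => genFunctional_real_eq_integral hm s
  rw [hfun]
  exact iteratedDeriv_two_integral_explin (L := 2 * Fintype.card (TorusSite d n)) hg₀.le (norm_nonneg _)
    continuous_topBase (norm_topBase_le hg₀ hz) continuous_ellRe two_card_nonneg norm_ellRe_le _

/-- `∂_t² Σ(it1,-it1)|₀ = επ^{-|Λ|} ∫ ℓ₂² T`. [folklore] -/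
theorem iteratedDeriv_two_genFunctional_imag (hm : 0 < m2) (hg₀ : 0 < g₀) (hz : -1 < z₀) :
    iteratedDeriv 2 (fun t : ℝ => genFunctional d n m2 g₀ ν₀ z₀ (fun _ => (t : ℂ) * I)) 0 =
      normConst d n * ∫ φ, (ellIm φ) ^ 2 * topBase d n m2 g₀ ν₀ z₀ φ := by
  have hfun : (fun t : ℝ => genFunctional d n m2 g₀ ν₀ z₀ (fun _ => (t : ℂ) * I)) =
      fun t => normConst d n * ∫ φ, explinIntegrand ellIm (topBase d n m2 g₀ ν₀ z₀) 0 t φ :=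
    funext fun t => genFunctional_imag_eq_integral hm t
  rw [hfun]
  exact iteratedDeriv_two_integral_explin (L := 2 * Fintype.card (TorusSite d n)) hg₀.le (norm_nonneg _)
    continuous_topBase (norm_topBase_le hg₀ hz) continuous_ellIm two_card_nonneg norm_ellIm_le _

/-- `ℓ² T` is integrable for `ℓ ∈ {ℓ₁, ℓ₂}`. [folklore] -/
theorem integrable_sq_mul_topBase (hg₀ : 0 < g₀) (hz : -1 < z₀) {ℓ : (TorusSite d n → ℂ) → ℂ}
    (hℓ : Continuous ℓ) (hℓb : ∀ φ, ‖ℓ φ‖ ≤ 2 * Fintype.card (TorusSite d n) * (1 + ‖φ‖)) :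
    Integrable fun φ => (ℓ φ) ^ 2 * topBase d n m2 g₀ ν₀ z₀ φ := by
  have h := integrable_explinIntegrand (L := 2 * Fintype.card (TorusSite d n)) (T := topBase d n m2 g₀ ν₀ z₀)
    hg₀.le (norm_nonneg _) continuous_topBase (norm_topBase_le hg₀ hz) hℓ two_card_nonneg hℓb 2 0
  refine h.congr (Eventually.of_forall fun φ => ?_)
  simp [explinIntegrand]

/-- **`D²Σ(0,0;1,1) = E_C((1,φ̄)(1,φ) Z₀)`** (differentiation under the super-integral). [cite: BauerschmidtBrydgesSlade2015LogCorr, §4.1, eq. (4.16) (proof: "By (4.13) and translation invariance … the right-hand sides involve the directional derivative")] -/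
theorem D2Sigma_eq (hm : 0 < m2) (hg₀ : 0 < g₀) (hz : -1 < z₀) :
    D2Sigma d n m2 g₀ ν₀ z₀ =
      superExpectation (freeCovariance d n m2) (ofFun (fun φ => sumBar φ * sumPhi φ) * boltzmannZ0 g₀ ν₀ z₀) := by
  simp only [D2Sigma, wirtingerD2]
  rw [iteratedDeriv_two_genFunctional_real hm hg₀ hz, iteratedDeriv_two_genFunctional_imag hm hg₀ hz,
    superExpectation_ofFun_mul_boltzmannZ0_eq_integral hm, ← normConst, ← mul_add,
    ← integral_add (integrable_sq_mul_topBase hg₀ hz continuous_ellRe norm_ellRe_le)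
      (integrable_sq_mul_topBase hg₀ hz continuous_ellIm norm_ellIm_le),
    ← mul_assoc, mul_comm (1 / 4 : ℂ), mul_assoc, ← integral_const_mul]
  congr 1
  refine integral_congr_ae (Eventually.of_forall fun φ => ?_)
  dsimp only
  rw [← quarter_ellRe_sq_add_ellIm_sq]
  ring

/-- **BBS 2015, eq. (4.16): `χ̂_N = |Λ|⁻¹ D²Σ(0,0;1,1)`** (`m² > 0`, `g₀ > 0`, `ν₀ ∈ ℝ`, `z₀ > -1`).
[cite: BauerschmidtBrydgesSlade2015LogCorr, §4.1, eq. (4.16)] -/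
theorem chiHatNForm_eq_D2Sigma (hm : 0 < m2) (hg₀ : 0 < g₀) (ν₀ : ℝ) (hz : -1 < z₀) :
    chiHatNForm d n m2 g₀ ν₀ z₀ = (Fintype.card (TorusSite d n) : ℂ)⁻¹ * D2Sigma d n m2 g₀ ν₀ z₀ := by
  rw [D2Sigma_eq hm hg₀ hz, chiHatNForm_eq_card_inv_mul hm hg₀ ν₀ hz]
  rfl

/-! #### `Z_N⁰` along the axes and eq. (4.27) -/

/-- `Σ(0) = E_C Z₀ = 1`. [folklore] -/
theorem genFunctional_zero (hm : 0 < m2) (hg₀ : 0 < g₀) (ν₀ : ℝ) (hz : -1 < z₀) :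
    genFunctional d n m2 g₀ ν₀ z₀ (fun _ => 0) = 1 := by
  have h : extSource (d := d) (n := n) (fun _ => (0 : ℂ)) = 1 := by
    unfold extSource
    rw [← ofFun_one]
    congr 1
    funext φ
    simp [pair]
  rw [genFunctional, h, one_mul]
  exact superExpectation_boltzmannZ0 hm hg₀ ν₀ hz

/-- `Z_N⁰(s1) = e^{-|Λ|m²s²} Σ(m²s·1)` (from (4.25)–(4.26) at `z = m²s`). [folklore] -/
theorem ZN0_real_eq (hm : 0 < m2) (s : ℝ) :
    ZN0 d n m2 g₀ ν₀ z₀ (fun _ => (s : ℂ)) =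
      cexp (-((((Fintype.card (TorusSite d n) * m2 : ℝ)) : ℂ) * (s : ℂ) ^ 2)) *
        genFunctional d n m2 g₀ ν₀ z₀ (fun _ => (((m2 * s : ℝ)) : ℂ)) := by
  have hm' : (m2 : ℂ) ≠ 0 := by exact_mod_cast hm.ne'
  have h := genFunctional_const (d := d) (n := n) hm g₀ ν₀ z₀ ((m2 : ℂ) * (s : ℂ))
  have h1 : (fun _ : TorusSite d n => (m2 : ℂ) * (s : ℂ) / (m2 : ℂ)) = fun _ => (s : ℂ) := by
    funext x; field_simp
  have hz : (m2 : ℂ) * (s : ℂ) * conj ((m2 : ℂ) * (s : ℂ)) = (m2 : ℂ) ^ 2 * (s : ℂ) ^ 2 := by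
    simp only [map_mul, Complex.conj_ofReal]; ring
  have h2 : cexp ((Fintype.card (TorusSite d n) : ℂ) * ((m2 : ℂ) * (s : ℂ) * conj ((m2 : ℂ) * (s : ℂ))) / (m2 : ℂ)) =
      cexp ((((Fintype.card (TorusSite d n) * m2 : ℝ)) : ℂ) * (s : ℂ) ^ 2) := by
    rw [hz]; congr 1; push_cast; field_simp
  rw [h1, h2] at h
  rw [show (((m2 * s : ℝ)) : ℂ) = (m2 : ℂ) * (s : ℂ) by push_cast; ring, h, ← mul_assoc, ← Complex.exp_add,
    neg_add_cancel, Complex.exp_zero, one_mul]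

/-- `Z_N⁰(it1) = e^{-|Λ|m²t²} Σ(m²it·1)`. [folklore] -/
theorem ZN0_imag_eq (hm : 0 < m2) (t : ℝ) :
    ZN0 d n m2 g₀ ν₀ z₀ (fun _ => (t : ℂ) * I) =
      cexp (-((((Fintype.card (TorusSite d n) * m2 : ℝ)) : ℂ) * (t : ℂ) ^ 2)) *
        genFunctional d n m2 g₀ ν₀ z₀ (fun _ => (((m2 * t : ℝ)) : ℂ) * I) := by
  have hm' : (m2 : ℂ) ≠ 0 := by exact_mod_cast hm.ne'
  have h := genFunctional_const (d := d) (n := n) hm g₀ ν₀ z₀ ((m2 : ℂ) * ((t : ℂ) * I))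
  have h1 : (fun _ : TorusSite d n => (m2 : ℂ) * ((t : ℂ) * I) / (m2 : ℂ)) = fun _ => (t : ℂ) * I := by
    funext x; field_simp
  have hz : (m2 : ℂ) * ((t : ℂ) * I) * conj ((m2 : ℂ) * ((t : ℂ) * I)) = (m2 : ℂ) ^ 2 * (t : ℂ) ^ 2 := by
    simp only [map_mul, Complex.conj_ofReal, Complex.conj_I]
    have hI : I * I = -1 := Complex.I_mul_I
    linear_combination (-(m2 : ℂ) ^ 2 * (t : ℂ) ^ 2) * hI
  have h2 : cexp ((Fintype.card (TorusSite d n) : ℂ) * ((m2 : ℂ) * ((t : ℂ) * I) * conj ((m2 : ℂ) * ((t : ℂ) * I))) /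
      (m2 : ℂ)) = cexp ((((Fintype.card (TorusSite d n) * m2 : ℝ)) : ℂ) * (t : ℂ) ^ 2) := by
    rw [hz]; congr 1; push_cast; field_simp
  rw [h1, h2] at h
  rw [show (((m2 * t : ℝ)) : ℂ) * I = (m2 : ℂ) * ((t : ℂ) * I) by push_cast; ring, h, ← mul_assoc,
    ← Complex.exp_add, neg_add_cancel, Complex.exp_zero, one_mul]

/-- **`D²Z_N⁰(0,0;1,1) = m⁴ D²Σ(0,0;1,1) - |Λ|m²`** (product rule at `0` with `Z_N⁰(0) = E_C Z₀ = 1`).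
[cite: BauerschmidtBrydgesSlade2015LogCorr, §4.1, eqs. (4.25)–(4.27)] -/
theorem D2ZN0_eq (hm : 0 < m2) (hg₀ : 0 < g₀) (ν₀ : ℝ) (hz : -1 < z₀) :
    D2ZN0 d n m2 g₀ ν₀ z₀ = (m2 : ℂ) ^ 2 * D2Sigma d n m2 g₀ ν₀ z₀ - Fintype.card (TorusSite d n) * (m2 : ℂ) := by
  set T := topBase d n m2 g₀ ν₀ z₀ with hT
  set K : ℝ := Fintype.card (TorusSite d n) * m2 with hK
  -- the axis functions of `Σ` and their derivatives
  set S₁ : ℝ → ℂ := fun r => normConst d n * ∫ φ, explinIntegrand ellRe T 0 r φ with hS₁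
  set S₂ : ℝ → ℂ := fun r => normConst d n * ∫ φ, explinIntegrand ellIm T 0 r φ with hS₂
  have hS₁eq : ∀ r : ℝ, genFunctional d n m2 g₀ ν₀ z₀ (fun _ => (r : ℂ)) = S₁ r := fun r =>
    genFunctional_real_eq_integral hm r
  have hS₂eq : ∀ r : ℝ, genFunctional d n m2 g₀ ν₀ z₀ (fun _ => (r : ℂ) * I) = S₂ r := fun r =>
    genFunctional_imag_eq_integral hm r
  have hd₁ := fun k r => hasDerivAt_genFunctional_real (d := d) (n := n) (m2 := m2) (ν₀ := ν₀) hg₀ hz k r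
  have hd₂ := fun k r => hasDerivAt_genFunctional_imag (d := d) (n := n) (m2 := m2) (ν₀ := ν₀) hg₀ hz k r
  -- `Z_N⁰` along the axes
  have hG₁ : (fun s : ℝ => ZN0 d n m2 g₀ ν₀ z₀ (fun _ => (s : ℂ))) =
      fun s : ℝ => cexp (-((K : ℂ) * (s : ℂ) ^ 2)) * S₁ (m2 * s) := by
    funext s; rw [ZN0_real_eq hm s, hS₁eq, hK]
  have hG₂ : (fun t : ℝ => ZN0 d n m2 g₀ ν₀ z₀ (fun _ => (t : ℂ) * I)) =
      fun t : ℝ => cexp (-((K : ℂ) * (t : ℂ) ^ 2)) * S₂ (m2 * t) := by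
    funext t; rw [ZN0_imag_eq hm t, hS₂eq, hK]
  have h1 := iteratedDeriv_two_cexp_mul_comp (S := S₁) (fun r => hd₁ 0 r) (fun r => hd₁ 1 r) K m2
  have h2 := iteratedDeriv_two_cexp_mul_comp (S := S₂) (fun r => hd₂ 0 r) (fun r => hd₂ 1 r) K m2
  -- values at `0`
  have hS₁0 : S₁ 0 = 1 := by
    rw [← hS₁eq 0, Complex.ofReal_zero]; exact genFunctional_zero hm hg₀ ν₀ hz
  have hS₂0 : S₂ 0 = 1 := by
    rw [← hS₂eq 0, Complex.ofReal_zero, zero_mul]; exact genFunctional_zero hm hg₀ ν₀ hz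
  have hSig1 : iteratedDeriv 2 (fun s : ℝ => genFunctional d n m2 g₀ ν₀ z₀ (fun _ => (s : ℂ))) 0 =
      normConst d n * ∫ φ, explinIntegrand ellRe T 2 0 φ := by
    rw [iteratedDeriv_two_genFunctional_real hm hg₀ hz]
    congr 1
    exact integral_congr_ae (Eventually.of_forall fun φ => by simp [explinIntegrand, hT])
  have hSig2 : iteratedDeriv 2 (fun t : ℝ => genFunctional d n m2 g₀ ν₀ z₀ (fun _ => (t : ℂ) * I)) 0 =
      normConst d n * ∫ φ, explinIntegrand ellIm T 2 0 φ := by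
    rw [iteratedDeriv_two_genFunctional_imag hm hg₀ hz]
    congr 1
    exact integral_congr_ae (Eventually.of_forall fun φ => by simp [explinIntegrand, hT])
  simp only [D2ZN0, D2Sigma, wirtingerD2]
  rw [hG₁, hG₂, h1, h2, hS₁0, hS₂0, hSig1, hSig2, hK]
  push_cast
  ring

/-- **BBS 2015, eq. (4.27): `χ̂_N = 1/m² + (1/m⁴)|Λ|⁻¹ D²Z_N⁰(0,0;1,1)`** (`m² > 0`, `g₀ > 0`, `ν₀ ∈ ℝ`,
`z₀ > -1`; here `m2 = m²`). [cite: BauerschmidtBrydgesSlade2015LogCorr, §4.1, eq. (4.27)] -/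
theorem chiHatNForm_eq_D2ZN0 (hm : 0 < m2) (hg₀ : 0 < g₀) (ν₀ : ℝ) (hz : -1 < z₀) :
    chiHatNForm d n m2 g₀ ν₀ z₀ = 1 / (m2 : ℂ) +
      (1 / (m2 : ℂ) ^ 2) * ((Fintype.card (TorusSite d n) : ℂ)⁻¹ * D2ZN0 d n m2 g₀ ν₀ z₀) := by
  have hm' : (m2 : ℂ) ≠ 0 := by exact_mod_cast hm.ne'
  have hcard : (Fintype.card (TorusSite d n) : ℂ) ≠ 0 := by
    exact_mod_cast (Fintype.card_pos (α := TorusSite d n)).ne'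
  rw [chiHatNForm_eq_D2Sigma hm hg₀ ν₀ hz, D2ZN0_eq hm hg₀ ν₀ hz]
  field_simp
  ring

end Torus

end CTWSAW

end Literature.Barriers.CriticalPhenomena
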